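import Mathlib.Data.ZMod.ValMinAbs
import Literature.MathematicalPhysics.QuantumFieldTheory.Balaban1983to89.AveragingRT
import Literature.MathematicalPhysics.QuantumFieldTheory.Balaban1983to89.T4ReflectionCone
import Literature.MathematicalPhysics.QuantumFieldTheory.Balaban1983to89.B15DeterminingSets
import HarnessLib

/-!
# Route `UnitScaleTilt`, crux K1 «MinimiserStabilityRegPr» (stmt-QuantumFields-19200), route-R (β) R0 REM2ˢ «(n3)₂-sym» = H2-1ˢ, px21 g7's N-line, file N2′ part 1 —
# TORUS LETTERS FOR THE SPARSE Λ-CHANNEL: the coordinate torus distance `d(a,b) := |valMinAbs (a − b)|`, the CENTRE LABELS `n·L^r + (L^r−1)∕2` of the iterated inclusion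
# `emb`, and THE CENTRE CHAINS `S^l_i = {w ∈ T^{(i)} : ∀ κ, (w κ).val % L^{l−i} = (L^{l−i}−1)∕2}` (= the level-`i` centres of the level-`l` sites, bijectively)

Cell `ym3-torus`, width seat `ym-ust-19200-w5` (gen 8); px21 g7 N-LINE NAMER WORD №1∕№2 (2026-08-29) «N2′ NESTED SUPPORT FAMILIES + CENTRE CHAINS → w5 g8».  THEOREMS ONLY
(0 `def`, 0 `sorry`); `--supports stmt-QuantumFields-19200 --as helper`, count-neutral.  Generic `Params` (any `d`, any odd `L > 1`), standing range `≤ m + K` displayed.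
YM₃ on T³ is a ladder rung (R3), not the Clay problem; nothing here claims `hN2s`, H2-1, (β), the stub, the crux, d = 4 or the mass gap.

WHY.  px21's sparse engine ✓p708624 `Prop7TrueLinSourcedSparseL1.sum_norm_sourced_le_sparse` reads the coarse gauge channel only on CENTRE CHAINS `S i` with `S k = univ` and
`z ∈ S (i+1) → emb z ∈ S i`, and the local propagation ✓`…sum_norm_sourcedReduced_le_local` ∕ ✓p708296 `Prop7TrueLinIterLocalL2` runs on NESTED bond families around each centre
(part 2, `Prop7TrueLinSparseSupport`).  This file supplies the lattice letters both parts stand on, in `ZMod.valMinAbs` ∕ `.val` arithmetic over lit `Setup`∕`TorusGeometry`.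

WHAT IS PROVED (ns `…Theorems.Prop7TorusCentreChains`).
* §1 `ZMod` distance letters: `natAbs_valMinAbs_intCast_le` (least lift), `natAbs_valMinAbs_sub_le` (triangle), `natAbs_valMinAbs_sub_comm`, `natAbs_valMinAbs_natCast_sub_natCast_le`.
* §2 label arithmetic: `pow_eq_two_mul_half_add_one`, `half_mul_pow_add_half_pow`, `centreLabel_succ` (`(nL^r + (L^r−1)∕2)L + (L−1)∕2 = nL^{r+1} + (L^{r+1}−1)∕2`), `sitesPerDir_eq_mul_pow`,
  `centreLabel_lt` (no wrap-around in the standing range).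
* §3 site letters: `natAbs_valMinAbs_shift_sub_le` (`d(x+e_μ, x)_κ ≤ 1`), `natAbs_valMinAbs_sub_emb_blockOf_le` (`d(x, emb (blockOf x))_κ ≤ (L−1)∕2`), ★`natAbs_valMinAbs_emb_sub_emb_le`
  (`d(emb y, emb y′)_κ ≤ L·d(y, y′)_κ`), `emb_centre` (centre sites telescope under `emb`), ★`embIter_eq_centre` (lit `B15DeterminingSets.embIter k y` IS the centre label `n·L^k + (L^k−1)∕2`).
* §4 the chains: `centres_top` (`S^l_l = univ` = N1 §4's `hSk`), ★`emb_mem_centres` (`emb`-closure = N1 §3's `hS`), `centre_injective`, ★★`sum_centres_eq`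
  (`Σ_{w ∈ S^l_i} g w = Σ_{y : T^{(l)}} g (centre_i y)`), `card_centres` (`#S^l_i = #T^{(l)}`).
HONEST SCOPE.  Lattice bookkeeping; no analysis.  [folklore] over [Balaban1987RG1] (0.1)–(0.3) pp.251–252 (centred blocks, `L` odd) and [Balaban1983RegularityDecay] (1.4) p.572 (`embIter`).
-/

set_option autoImplicit false

namespace Summit.QuantumFields.YangMills.Theorems.Prop7TorusCentreChains

open Literature.MathematicalPhysics.QuantumFieldTheory.Balaban1983to89
open Finset

/-! ## §1 Torus-distance letters on `ZMod N`: `d(a,b) := |valMinAbs (a − b)|` -/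

/-- `valMinAbs` is the least lift: `|(m : ZMod N).valMinAbs| ≤ |m|`. [folklore] -/
theorem natAbs_valMinAbs_intCast_le {N : ℕ} [NeZero N] (m : ℤ) : ((m : ZMod N).valMinAbs).natAbs ≤ m.natAbs :=
  ZMod.natAbs_min_of_le_div_two N _ _ (by rw [ZMod.coe_valMinAbs]) (ZMod.natAbs_valMinAbs_le _)

/-- Triangle inequality for the coordinate torus distance. [folklore] -/
theorem natAbs_valMinAbs_sub_le {N : ℕ} [NeZero N] (a b c : ZMod N) :
    ((a - c).valMinAbs).natAbs ≤ ((a - b).valMinAbs).natAbs + ((b - c).valMinAbs).natAbs := by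
  have h : a - c = (a - b) + (b - c) := by abel
  rw [h]
  exact (ZMod.natAbs_valMinAbs_add_le _ _).trans (Int.natAbs_add_le _ _)

/-- Symmetry of the coordinate torus distance. [folklore] -/
theorem natAbs_valMinAbs_sub_comm {N : ℕ} [NeZero N] (a b : ZMod N) :
    ((a - b).valMinAbs).natAbs = ((b - a).valMinAbs).natAbs := by
  rw [← neg_sub, ZMod.natAbs_valMinAbs_neg]

/-- The distance of two natural labels is at most the distance of the labels in `ℤ`. [folklore] -/
theorem natAbs_valMinAbs_natCast_sub_natCast_le {N : ℕ} [NeZero N] (p q : ℕ) :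
    (((p : ZMod N) - (q : ZMod N)).valMinAbs).natAbs ≤ ((p : ℤ) - (q : ℤ)).natAbs := by
  have h : ((p : ZMod N) - (q : ZMod N)) = (((p : ℤ) - (q : ℤ) : ℤ) : ZMod N) := by push_cast; ring
  rw [h]
  exact natAbs_valMinAbs_intCast_le _

variable {P : Params}

/-! ## §2 Label arithmetic: odd powers, the two telescopings of the centre labels, no wrap-around -/

/-- `L^r` is odd, so `L^r = 2·((L^r−1)∕2) + 1` (cf. lit `T4UndoubledRP.two_mul_half_pow_add_one`, not imported here). [folklore] -/
theorem pow_eq_two_mul_half_add_one (P : Params) (r : ℕ) : P.L ^ r = 2 * ((P.L ^ r - 1) / 2) + 1 := by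
  obtain ⟨k, hk⟩ := P.hL.1.pow (n := r)
  omega

/-- `(L−1)∕2·L^k + (L^k−1)∕2 = (L^{k+1}−1)∕2` (the other telescoping of the centre labels). [folklore] -/
theorem half_mul_pow_add_half_pow (P : Params) (k : ℕ) :
    (P.L - 1) / 2 * P.L ^ k + (P.L ^ k - 1) / 2 = (P.L ^ (k + 1) - 1) / 2 := by
  have h1 := (pow_eq_two_mul_half_add_one P k).symm
  have h2 := (pow_eq_two_mul_half_add_one P (k + 1)).symm
  have h3 := AveragingRT.two_mul_half_add_one P
  set a := (P.L ^ k - 1) / 2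
  set b := (P.L ^ (k + 1) - 1) / 2
  set h := (P.L - 1) / 2
  have hpow : P.L ^ (k + 1) = P.L ^ k * P.L := pow_succ _ _
  have hb : b = 2 * a * h + a + h := by nlinarith [h1, h2, h3, hpow]
  rw [hb]
  nlinarith [h1, h3, hpow]

/-- The centre labels telescope: `(nL^r + (L^r−1)∕2)·L + (L−1)∕2 = nL^{r+1} + (L^{r+1}−1)∕2`. [folklore] -/
theorem centreLabel_succ (P : Params) (n r : ℕ) :
    (n * P.L ^ r + (P.L ^ r - 1) / 2) * P.L + (P.L - 1) / 2 = n * P.L ^ (r + 1) + (P.L ^ (r + 1) - 1) / 2 := by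
  have h1 := (pow_eq_two_mul_half_add_one P r).symm
  have h2 := (pow_eq_two_mul_half_add_one P (r + 1)).symm
  have h3 := AveragingRT.two_mul_half_add_one P
  set a := (P.L ^ r - 1) / 2
  set b := (P.L ^ (r + 1) - 1) / 2
  set h := (P.L - 1) / 2
  have hpow : P.L ^ (r + 1) = P.L ^ r * P.L := pow_succ _ _
  -- `2b + 1 = L^{r+1} = (2a+1)(2h+1) = 4ah + 2a + 2h + 1`
  have hb : b = 2 * a * h + a + h := by nlinarith [h1, h2, h3, hpow]
  rw [hb]
  nlinarith [h1, h3, hpow]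

/-- In the standing range, `sitesPerDir i = sitesPerDir (i + r) · L^r`. [folklore] -/
theorem sitesPerDir_eq_mul_pow (P : Params) {i r : ℕ} (h : i + r ≤ P.m + P.K) : P.sitesPerDir i = P.sitesPerDir (i + r) * P.L ^ r := by
  induction r with
  | zero => simp
  | succ r ih =>
    rw [ih (by omega), show i + (r + 1) = (i + r) + 1 by omega, P.sitesPerDir_eq_mul_succ (j := i + r) (by omega), pow_succ]
    ring

/-- The centre label at depth `r` below a level-`(i+r)` coordinate label `n < sitesPerDir (i+r)` is a genuine level-`i` label (no wrap-around).
[folklore] -/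
theorem centreLabel_lt (P : Params) {i r : ℕ} (h : i + r ≤ P.m + P.K) {n : ℕ} (hn : n < P.sitesPerDir (i + r)) :
    n * P.L ^ r + (P.L ^ r - 1) / 2 < P.sitesPerDir i := by
  rw [sitesPerDir_eq_mul_pow P h]
  have h1 := (pow_eq_two_mul_half_add_one P r).symm
  have hn' : n + 1 ≤ P.sitesPerDir (i + r) := hn
  have := Nat.mul_le_mul_right (P.L ^ r) hn'
  rw [Nat.add_mul, one_mul] at this
  omega

/-! ## §3 Site letters: one lattice step, block membership, the inclusion `emb` scales distances by `L`, centre sites telescope -/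

/-- One lattice step moves each coordinate by at most one: `d(x + e_μ, x)_κ ≤ 1`. [folklore] -/
theorem natAbs_valMinAbs_shift_sub_le {i : ℕ} (x : Site P i) (μ κ : Fin P.d) :
    ((x.shift μ κ - x κ).valMinAbs).natAbs ≤ 1 := by
  unfold Site.shift
  by_cases h : κ = μ
  · subst h
    rw [Function.update_self, add_sub_cancel_left]
    have := natAbs_valMinAbs_intCast_le (N := P.sitesPerDir i) (1 : ℤ)
    simpa using this
  · rw [Function.update_of_ne h, sub_self, ZMod.valMinAbs_zero]
    simp

/-- A fine site lies within `(L−1)∕2` of the centre `emb (blockOf x)` of its block, coordinatewise (standing range). [cite: Balaban1987RG1, (0.3) p.252] -/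
theorem natAbs_valMinAbs_sub_emb_blockOf_le {i : ℕ} (hi : i + 1 ≤ P.m + P.K) (x : Site P i) (κ : Fin P.d) :
    ((x κ - emb (blockOf x) κ).valMinAbs).natAbs ≤ (P.L - 1) / 2 := by
  have hL := AveragingRT.two_mul_half_add_one P
  have hq : (blockOf x κ).val = (x κ).val / P.L := Site.val_blockOf hi x κ
  have hv : (x κ).val / P.L * P.L + (x κ).val % P.L = (x κ).val := Nat.div_add_mod' _ _
  have hρ : (x κ).val % P.L < P.L := Nat.mod_lt _ P.L_pos
  set w : ℕ := (x κ).val / P.L * P.L with hw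
  set ρ : ℕ := (x κ).val % P.L with hρdef
  set hh : ℕ := (P.L - 1) / 2 with hhh
  have hx : x κ = (((x κ).val : ℕ) : ZMod (P.sitesPerDir i)) := (ZMod.natCast_zmod_val (x κ)).symm
  have he : emb (blockOf x) κ = (((w + hh : ℕ)) : ZMod (P.sitesPerDir i)) := by
    show ((((blockOf x κ).val * P.L + (P.L - 1) / 2 : ℕ)) : ZMod (P.sitesPerDir i)) = _
    rw [hq]
  rw [hx, he]
  refine (natAbs_valMinAbs_natCast_sub_natCast_le _ _).trans ?_
  have : (((x κ).val : ℕ) : ℤ) - ((w + hh : ℕ) : ℤ) = (ρ : ℤ) - (hh : ℤ) := by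
    push_cast
    omega
  rw [this]
  omega

/-- `emb` scales coordinate distances by exactly the block side; we record `d(emb y, emb y')_κ ≤ L·d(y, y')_κ` (standing range). [cite: Balaban1987RG1, (0.1) p.251] -/
theorem natAbs_valMinAbs_emb_sub_emb_le {i : ℕ} (hi : i + 1 ≤ P.m + P.K) (y y' : Site P (i + 1)) (κ : Fin P.d) :
    ((emb y κ - emb y' κ).valMinAbs).natAbs ≤ P.L * ((y κ - y' κ).valMinAbs).natAbs := by
  set m : ℤ := (y κ - y' κ).valMinAbs with hm
  set hh : ℕ := (P.L - 1) / 2 with hhh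
  set a : ℕ := (y κ).val * P.L + hh with ha
  set a' : ℕ := (y' κ).val * P.L + hh with ha'
  have hN : (P.sitesPerDir i : ℤ) = (P.sitesPerDir (i + 1) : ℤ) * P.L := by
    rw [P.sitesPerDir_eq_mul_succ hi]; push_cast; ring
  -- `y − y' ≡ m (mod N′)`
  have h1 : (((((y κ).val : ℤ) - ((y' κ).val : ℤ) : ℤ)) : ZMod (P.sitesPerDir (i + 1))) = (m : ZMod (P.sitesPerDir (i + 1))) := by
    rw [hm, ZMod.coe_valMinAbs]
    push_cast
    rw [ZMod.natCast_zmod_val, ZMod.natCast_zmod_val]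
  rw [ZMod.intCast_eq_intCast_iff_dvd_sub] at h1
  -- hence `L(y − y') ≡ L m (mod N = N′L)`
  have haa : (a : ℤ) - (a' : ℤ) = (P.L : ℤ) * (((y κ).val : ℤ) - ((y' κ).val : ℤ)) := by
    rw [ha, ha']; push_cast; ring
  have h2 : ((((a : ℤ) - (a' : ℤ) : ℤ)) : ZMod (P.sitesPerDir i)) = ((P.L * m : ℤ) : ZMod (P.sitesPerDir i)) := by
    rw [ZMod.intCast_eq_intCast_iff_dvd_sub, hN, haa, ← mul_sub, mul_comm ((P.sitesPerDir (i + 1) : ℤ))]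
    exact mul_dvd_mul_left _ h1
  have hey : emb y κ = ((a : ℕ) : ZMod (P.sitesPerDir i)) := rfl
  have hey' : emb y' κ = ((a' : ℕ) : ZMod (P.sitesPerDir i)) := rfl
  have he : emb y κ - emb y' κ = ((((a : ℤ) - (a' : ℤ) : ℤ)) : ZMod (P.sitesPerDir i)) := by
    rw [hey, hey']; push_cast; ring
  rw [he, h2]
  refine (natAbs_valMinAbs_intCast_le _).trans ?_
  rw [Int.natAbs_mul, Int.natAbs_natCast]

/-- The centre sites telescope under `emb`: `emb (n·L^r + (L^r−1)∕2) = n·L^{r+1} + (L^{r+1}−1)∕2` coordinatewise, for labels `n κ < sitesPerDir (i + 1 + r)`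
(standing range). [folklore] -/
theorem emb_centre {i r : ℕ} (h : i + 1 + r ≤ P.m + P.K) (n : Fin P.d → ℕ) (hn : ∀ κ, n κ < P.sitesPerDir (i + 1 + r)) :
    emb (fun κ => ((n κ * P.L ^ r + (P.L ^ r - 1) / 2 : ℕ) : ZMod (P.sitesPerDir (i + 1))))
      = fun κ => ((n κ * P.L ^ (r + 1) + (P.L ^ (r + 1) - 1) / 2 : ℕ) : ZMod (P.sitesPerDir i)) := by
  funext κ
  have hlt := centreLabel_lt P h (hn κ)
  show ((((((n κ * P.L ^ r + (P.L ^ r - 1) / 2 : ℕ) : ZMod (P.sitesPerDir (i + 1)))).val * P.L + (P.L - 1) / 2 : ℕ)) : ZMod (P.sitesPerDir i)) = _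
  rw [ZMod.val_natCast, Nat.mod_eq_of_lt hlt, centreLabel_succ]


/-- The iterated centre embedding in labels: `embIter k y = (n·L^k + (L^k−1)∕2)` coordinatewise, `n = (y κ).val` (standing range `k ≤ m + K`).
[cite: Balaban1987RG1, (0.1) p.251] -/
theorem embIter_eq_centre : ∀ (k : ℕ), k ≤ P.m + P.K → ∀ y : Site P k,
    B15DeterminingSets.embIter k y = fun κ => (((y κ).val * P.L ^ k + (P.L ^ k - 1) / 2 : ℕ) : ZMod (P.sitesPerDir 0))
  | 0, _, y => by
    funext κ
    simp [B15DeterminingSets.embIter]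
  | k + 1, hk, y => by
    funext κ
    have hk' : k ≤ P.m + P.K := by omega
    rw [show B15DeterminingSets.embIter (k + 1) y = B15DeterminingSets.embIter k (emb y) from rfl,
      embIter_eq_centre k hk' (emb y)]
    simp only
    rw [Site.val_emb hk y κ, Nat.add_mul, ← half_mul_pow_add_half_pow P k, pow_succ]
    congr 1
    ring

/-! ## §4 The centre chains `S^l_i = {w : ∀ κ, (w κ).val % L^{l−i} = (L^{l−i}−1)∕2}` = the level-`i` centres of the level-`l` sites -/

/-- `S^l_l` is everything (`L^0 = 1`). [folklore] -/
theorem centres_top (l : ℕ) :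
    univ.filter (fun w : Site P l => ∀ κ, (w κ).val % P.L ^ (l - l) = (P.L ^ (l - l) - 1) / 2) = univ := by
  refine Finset.filter_true_of_mem fun w _ κ => ?_
  rw [Nat.sub_self, pow_zero, Nat.mod_one]
  norm_num

/-- The chains are `emb`-closed downwards (= N1 §3's `hS`): `w ∈ S^l_{i+1} → emb w ∈ S^l_i` (`i + 1 ≤ l`, standing range). [cite: Balaban1987RG1, (0.1) p.251] -/
theorem emb_mem_centres {l i : ℕ} (hil : i + 1 ≤ l) (hi : i + 1 ≤ P.m + P.K) (w : Site P (i + 1))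
    (hw : w ∈ univ.filter (fun w : Site P (i + 1) => ∀ κ, (w κ).val % P.L ^ (l - (i + 1)) = (P.L ^ (l - (i + 1)) - 1) / 2)) :
    emb w ∈ univ.filter (fun w : Site P i => ∀ κ, (w κ).val % P.L ^ (l - i) = (P.L ^ (l - i) - 1) / 2) := by
  rw [Finset.mem_filter] at hw ⊢
  refine ⟨Finset.mem_univ _, fun κ => ?_⟩
  set r : ℕ := l - (i + 1) with hr
  rw [show l - i = r + 1 by omega]
  have h1 := hw.2 κ
  have hq := Nat.div_add_mod ((w κ).val) (P.L ^ r)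
  rw [h1] at hq
  rw [Site.val_emb hi w κ, ← hq, show (P.L ^ r * ((w κ).val / P.L ^ r) + (P.L ^ r - 1) / 2) * P.L + (P.L - 1) / 2
      = ((P.L ^ r - 1) / 2 * P.L + (P.L - 1) / 2) + ((w κ).val / P.L ^ r) * P.L ^ (r + 1) by ring]
  have h2 : (P.L ^ r - 1) / 2 * P.L + (P.L - 1) / 2 = (P.L ^ (r + 1) - 1) / 2 := by
    have := centreLabel_succ P 0 r
    simpa using this
  rw [h2, Nat.add_mul_mod_self_right]
  have h3 := (pow_eq_two_mul_half_add_one P (r + 1)).symm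
  exact Nat.mod_eq_of_lt (by omega)

/-- The level-`i` centre map `y ↦ (n·L^{l−i} + (L^{l−i}−1)∕2)` of the level-`l` sites is injective (`i ≤ l ≤ m + K`). [folklore] -/
theorem centre_injective {l i : ℕ} (hil : i ≤ l) (hl : l ≤ P.m + P.K) :
    Function.Injective (fun y : Site P l => (fun κ => (((y κ).val * P.L ^ (l - i) + (P.L ^ (l - i) - 1) / 2 : ℕ) : ZMod (P.sitesPerDir i)))) := by
  intro y y' h
  funext κ
  have hκ := congrFun h κ
  simp only at hκ
  have hlt : ∀ w : Site P l, (w κ).val * P.L ^ (l - i) + (P.L ^ (l - i) - 1) / 2 < P.sitesPerDir i := fun w =>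
    centreLabel_lt P (i := i) (r := l - i) (by omega) (by rw [show i + (l - i) = l by omega]; exact ZMod.val_lt _)
  have hv := congrArg ZMod.val hκ
  rw [ZMod.val_natCast, ZMod.val_natCast, Nat.mod_eq_of_lt (hlt y), Nat.mod_eq_of_lt (hlt y')] at hv
  have hpos : 0 < P.L ^ (l - i) := pow_pos P.L_pos _
  apply ZMod.val_injective
  exact Nat.eq_of_mul_eq_mul_right hpos (by omega)

/-- ★ **SUMS OVER A CHAIN ARE SUMS OVER THE TOP LEVEL**: `Σ_{w ∈ S^l_i} g w = Σ_{y : T^{(l)}} g (centre_i y)` — the chain `S^l_i` IS the set of level-`i` centres of the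
level-`l` sites, bijectively (`i ≤ l ≤ m + K`). [cite: Balaban1987RG1, (0.1) p.251] -/
theorem sum_centres_eq {M : Type*} [AddCommMonoid M] {l i : ℕ} (hil : i ≤ l) (hl : l ≤ P.m + P.K) (g : Site P i → M) :
    ∑ w ∈ univ.filter (fun w : Site P i => ∀ κ, (w κ).val % P.L ^ (l - i) = (P.L ^ (l - i) - 1) / 2), g w
      = ∑ y : Site P l, g (fun κ => (((y κ).val * P.L ^ (l - i) + (P.L ^ (l - i) - 1) / 2 : ℕ) : ZMod (P.sitesPerDir i))) := by
  set r : ℕ := l - i with hr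
  have hN : P.sitesPerDir i = P.sitesPerDir l * P.L ^ r := by
    have := sitesPerDir_eq_mul_pow P (i := i) (r := r) (by omega)
    rwa [show i + r = l by omega] at this
  have hpos : 0 < P.L ^ r := pow_pos P.L_pos _
  have ha := (pow_eq_two_mul_half_add_one P r).symm
  symm
  refine Finset.sum_nbij (fun y : Site P l => (fun κ => (((y κ).val * P.L ^ r + (P.L ^ r - 1) / 2 : ℕ) : ZMod (P.sitesPerDir i))))
    (fun y _ => ?_) (fun y _ y' _ h => centre_injective hil hl h) (fun w hw => ?_) (fun _ _ => rfl)
  · -- the centre of `y` lies on the chain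
    refine Finset.mem_filter.mpr ⟨Finset.mem_univ _, fun κ => ?_⟩
    have hlt : (y κ).val * P.L ^ r + (P.L ^ r - 1) / 2 < P.sitesPerDir i :=
      centreLabel_lt P (i := i) (r := r) (by omega) (by rw [show i + r = l by omega]; exact ZMod.val_lt _)
    simp only
    rw [ZMod.val_natCast, Nat.mod_eq_of_lt hlt, Nat.add_comm, Nat.add_mul_mod_self_right]
    exact Nat.mod_eq_of_lt (by omega)
  · -- every chain site is a centre: `y κ := (w κ).val / L^r`
    have hw' := (Finset.mem_filter.mp (Finset.mem_coe.mp hw)).2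
    refine ⟨fun κ => ((((w κ).val / P.L ^ r : ℕ)) : ZMod (P.sitesPerDir l)), Finset.mem_coe.mpr (Finset.mem_univ _), ?_⟩
    funext κ
    have hdiv : (w κ).val / P.L ^ r < P.sitesPerDir l := by
      rw [Nat.div_lt_iff_lt_mul hpos, ← hN]; exact ZMod.val_lt _
    have hwκ := hw' κ
    simp only
    rw [ZMod.val_natCast, Nat.mod_eq_of_lt hdiv, ← hwκ, Nat.div_add_mod' ((w κ).val) (P.L ^ r), ZMod.natCast_zmod_val]

/-- **CARDINALITY**: `#S^l_i = #T^{(l)}` (`i ≤ l ≤ m + K`). [folklore] -/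
theorem card_centres {l i : ℕ} (hil : i ≤ l) (hl : l ≤ P.m + P.K) :
    (univ.filter (fun w : Site P i => ∀ κ, (w κ).val % P.L ^ (l - i) = (P.L ^ (l - i) - 1) / 2)).card = Fintype.card (Site P l) := by
  rw [Finset.card_eq_sum_ones, sum_centres_eq hil hl (fun _ => 1), Finset.sum_const, smul_eq_mul, mul_one, Finset.card_univ]

end Summit.QuantumFields.YangMills.Theorems.Prop7TorusCentreChains
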